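import Summits.AtomisticToContinuum.HydrodynamicLimit.Theorems.BoxDissipativeWeakStrongLocalGibbsFineScalePos
import Summits.AtomisticToContinuum.HydrodynamicLimit.Theorems.JParityClosureOddContactSymmetryGibbsInvariance
import Summits.AtomisticToContinuum.HydrodynamicLimit.Theorems.BoxDissipativeWeakStrongFluxClosureKinDevAEMeasurable
import Summits.AtomisticToContinuum.HydrodynamicLimit.Theorems.BoxDissipativeWeakStrongFluxClosureBoxIntegrableAlongFlow
import HarnessLib

/-!
# Crux `FluxClosure` (stmt-AtomisticToContinuum-9902, route BoxDissipativeWeakStrong), line `registered`,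
# rung-0 piece E1: the homogeneous fine-scale law of large numbers at all times

Support file (`--supports stmt-AtomisticToContinuum-9902`) for the registered stub
`homogeneous_fineScale_allTimes` (E1) of the lead's rung-0 (global equilibrium) programme.

For CONSTANT profiles `a₀ ≡ a > 0`, `u₀ ≡ u`, `θ₀ ≡ θ > 0` and reduced density `σ < σ₀(a)` there is a
constant `c₀ > 0` — the homogeneous density `ρ₀ = rhoLim (profileOf a) σ`, which is independent of the
point because the normalised profile of a constant activity is `β ≡ 1` — such that, for every flow family
`Φ`, every kinetic window `ℓ_N` (`0 < ℓ_N ≤ 1`, `ℓ_N → 0`, `(N+1) ℓ_N³ → ∞`) and the cube kernel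
`K_ℓ(x, y) = ℓ⁻³ 𝟙[∀ i, ‖yᵢ - xᵢ‖ < ℓ/2]`, the box fields `(ρ̂, m̂, Ê)` of the evolved configuration
`Φ_t z` are, at EVERY time `t ∈ ℝ`, `δ_N`-close in iterated-`lintegral` `L¹(P_N ⊗ dx)` to
`(c₀, c₀ u, E(c₀, u, θ))`, with `δ_N → 0` independent of `t`
(`P_N = localGibbsLaw σ a u θ N (Φ N)`).

Proof. (i) Statics: `δ_N := ∫ ofReal (∫ₓ |ρ̂ - c₀| + ‖m̂ - c₀ u‖ + |Ê - E₀| dx) dG_N` for the flow-free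
local Gibbs measure `G_N`, which tends to `0` by the fine-scale statics `LGFS.statics_kernel` at the box
kernel (exactly as in `LGFS.localGibbsFineScale_of_pos`), in the cluster-expansion regime
`exists_smallDensity` (which also gives `c₀ > 0`, `SmallDensity.rhoLim_pos`). (ii) For a frozen
configuration the three deviations are jointly measurable in (configuration, point)
(`FluxClosureB5.measurable_density` &c.) and bounded in the point (`FluxClosureB4.boxAtoms_bounds`), so
each iterated lower integral is at most `ofReal` of the Bochner `x`-integral of their sum. (iii) Time `t`:
the homogeneous local Gibbs law is STATIONARY under every hard-sphere flow
(`measurePreserving_flow_localGibbsLaw_const`), so composing the (measurable) inner integral with `Φ_t`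
does not change its `P_N`-integral, and `localGibbsLaw_eq` identifies `P_N` with `G_N`.

References: H. Spohn, *Large Scale Dynamics of Interacting Particles* (1991), Part I §2.3 (equilibrium
measures are invariant), §3.2; the tree files cited above.
-/

noncomputable section

namespace Summit.AtomisticToContinuum.HydrodynamicLimit.Theorems
namespace FluxClosureEq
namespace E1

open scoped BigOperators Topology Classical MeasureTheory ProbabilityTheory InnerProductSpace ENNReal
open Filter Set Function MeasureTheory
open Literature.MathematicalPhysics.KineticTheory Literature.Analysis.FluidPDE Literature.Analysis.FunctionSpaces

/-! ### Frozen-configuration bound on the three deviations -/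

/-- At a frozen configuration `z` and for a test function `0 ≤ χ ≤ κ`, the sum of the three box
deviations `|ρ̂ - c₀| + ‖m̂ - m₀‖ + |Ê - E₀|` is bounded by `κ (1 + V + V²) + (|c₀| + ‖m₀‖ + |E₀|)`,
`V = ∑ᵢ ‖vᵢ‖` (uniformly in the test function, in particular in the centre of a box kernel). -/
theorem E1_devSum_le {n : ℕ} (z : Config n (Fin 3) T3) {χ : T3 → ℝ} {kb : ℝ} (h0 : ∀ y, 0 ≤ χ y)
    (hb : ∀ y, χ y ≤ kb) (c₀ E₀ : ℝ) (m₀ : V3) :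
    |empiricalDensityField z χ - c₀| + ‖empiricalMomentumField z χ - m₀‖ +
        |empiricalEnergyField z χ - E₀| ≤
      kb * (1 + (∑ i, ‖(z i).2‖) + (∑ i, ‖(z i).2‖) ^ 2) + (|c₀| + ‖m₀‖ + |E₀|) := by
  set V := ∑ i, ‖(z i).2‖ with hV
  have hVi : ∀ i, ‖(z i).2‖ ≤ V := fun i =>
    Finset.single_le_sum (f := fun j => ‖(z j).2‖) (fun j _ => norm_nonneg _) (Finset.mem_univ i)
  have hV0 : 0 ≤ V := Finset.sum_nonneg fun i _ => norm_nonneg _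
  obtain ⟨⟨hD0, hDk⟩, hM, hE0', hEk⟩ := FluxClosureB4.boxAtoms_bounds z h0 hb hVi
  have h1 : |empiricalDensityField z χ - c₀| ≤ kb + |c₀| := by
    calc _ ≤ |empiricalDensityField z χ| + |c₀| := abs_sub _ _
      _ ≤ kb + |c₀| := by rw [abs_of_nonneg hD0]; exact add_le_add hDk le_rfl
  have h2 : ‖empiricalMomentumField z χ - m₀‖ ≤ V * kb + ‖m₀‖ := by
    calc _ ≤ ‖empiricalMomentumField z χ‖ + ‖m₀‖ := norm_sub_le _ _
      _ ≤ V * kb + ‖m₀‖ := add_le_add (hM.trans (mul_le_mul_of_nonneg_left hDk hV0)) le_rfl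
  have h3 : |empiricalEnergyField z χ - E₀| ≤ V ^ 2 * kb + |E₀| := by
    calc _ ≤ |empiricalEnergyField z χ| + |E₀| := abs_sub _ _
      _ ≤ V ^ 2 * kb + |E₀| := by
          rw [abs_of_nonneg hE0']
          exact add_le_add (hEk.trans (mul_le_mul_of_nonneg_left hDk (sq_nonneg _))) le_rfl
  have hsum : kb * (1 + V + V ^ 2) + (|c₀| + ‖m₀‖ + |E₀|) =
      (kb + |c₀|) + (V * kb + ‖m₀‖) + (V ^ 2 * kb + |E₀|) := by ring
  rw [hsum]
  exact add_le_add (add_le_add h1 h2) h3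

/-! ### Transport along the flow and domination -/

/-- **Stationarity + domination.** For constant profiles the local Gibbs law is invariant under every
hard-sphere flow map, so for a jointly measurable `f` the iterated integral of `ofReal (f (Φ_t z, x))`
equals that of `ofReal (f (z, x))` (now against the flow-free local Gibbs measure), which is at most the
`ofReal` of the Bochner `x`-integral of any pointwise larger `F ≥ 0` that is integrable in `x`. -/
theorem E1_lintegral_lintegral_flow_le (σ a θ : ℝ) (u : V3) (N : ℕ)
    (Φ : HardSphereFlow (Torus.geometry (Fin 3)) (hsDiameter σ N) (N + 1)) (t : ℝ)
    {f F : Config (N + 1) (Fin 3) T3 × T3 → ℝ} (hf : Measurable f)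
    (hfF : ∀ p, f p ≤ F p) (hF0 : ∀ p, 0 ≤ F p) (hFi : ∀ z, Integrable (fun x => F (z, x)) volume) :
    ∫⁻ z, (∫⁻ x, ENNReal.ofReal (f (Φ.flow t z, x)))
        ∂localGibbsLaw σ (fun _ => a) (fun _ => u) (fun _ => θ) N Φ ≤
      ∫⁻ z, ENNReal.ofReal (∫ x, F (z, x))
        ∂localGibbsMeasure σ (fun _ => a) (fun _ => u) (fun _ => θ) N := by
  have hG : Measurable fun z : Config (N + 1) (Fin 3) T3 => ∫⁻ x, ENNReal.ofReal (f (z, x)) :=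
    hf.ennreal_ofReal.lintegral_prod_right'
  calc ∫⁻ z, (∫⁻ x, ENNReal.ofReal (f (Φ.flow t z, x)))
        ∂localGibbsLaw σ (fun _ => a) (fun _ => u) (fun _ => θ) N Φ
      = ∫⁻ z, (∫⁻ x, ENNReal.ofReal (f (z, x)))
          ∂localGibbsLaw σ (fun _ => a) (fun _ => u) (fun _ => θ) N Φ :=
        (measurePreserving_flow_localGibbsLaw_const σ a θ u N Φ t).lintegral_comp hG
    _ = ∫⁻ z, (∫⁻ x, ENNReal.ofReal (f (z, x)))
          ∂localGibbsMeasure σ (fun _ => a) (fun _ => u) (fun _ => θ) N := by rw [localGibbsLaw_eq]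
    _ ≤ ∫⁻ z, (∫⁻ x, ENNReal.ofReal (F (z, x)))
          ∂localGibbsMeasure σ (fun _ => a) (fun _ => u) (fun _ => θ) N :=
        lintegral_mono fun z => lintegral_mono fun x => ENNReal.ofReal_le_ofReal (hfF _)
    _ = ∫⁻ z, ENNReal.ofReal (∫ x, F (z, x))
          ∂localGibbsMeasure σ (fun _ => a) (fun _ => u) (fun _ => θ) N :=
        lintegral_congr fun z =>
          (ofReal_integral_eq_lintegral_ofReal (hFi z) (ae_of_all _ fun x => hF0 (z, x))).symm

/-- **The three box deviations along the flow are dominated by the static deviation functional.** For a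
jointly measurable kernel `0 ≤ K ≤ κ`, constant profiles, every flow `Φ`, every time `t` and every
constant `c₀`, each of `E ∫⁻ₓ ofReal |ρ̂(Φ_t z) - c₀|`, `E ∫⁻ₓ ofReal ‖m̂(Φ_t z) - c₀ u‖`,
`E ∫⁻ₓ ofReal |Ê(Φ_t z) - E(c₀,u,θ)|` (expectation under the local Gibbs law) is at most
`∫ ofReal (∫ₓ |ρ̂ - c₀| + ‖m̂ - c₀ u‖ + |Ê - E(c₀,u,θ)| dx) dG_N` (flow-free local Gibbs measure). -/
theorem E1_boxDev_flow_le (σ a θ : ℝ) (u : V3) (c₀ : ℝ) (N : ℕ)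
    (Φ : HardSphereFlow (Torus.geometry (Fin 3)) (hsDiameter σ N) (N + 1)) (t : ℝ)
    {K : T3 → T3 → ℝ} {kb : ℝ} (hK : Measurable fun p : T3 × T3 => K p.1 p.2)
    (hK0 : ∀ x y, 0 ≤ K x y) (hKb : ∀ x y, K x y ≤ kb) :
    (∫⁻ z, (∫⁻ x, ENNReal.ofReal |empiricalDensityField (Φ.flow t z) (K x) - c₀|)
        ∂localGibbsLaw σ (fun _ => a) (fun _ => u) (fun _ => θ) N Φ ≤
      ∫⁻ z, ENNReal.ofReal (∫ x, (|empiricalDensityField z (K x) - c₀| +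
          ‖empiricalMomentumField z (K x) - c₀ • u‖ +
          |empiricalEnergyField z (K x) - totalEnergyDensity c₀ u θ|))
        ∂localGibbsMeasure σ (fun _ => a) (fun _ => u) (fun _ => θ) N) ∧
    (∫⁻ z, (∫⁻ x, ENNReal.ofReal ‖empiricalMomentumField (Φ.flow t z) (K x) - c₀ • u‖)
        ∂localGibbsLaw σ (fun _ => a) (fun _ => u) (fun _ => θ) N Φ ≤
      ∫⁻ z, ENNReal.ofReal (∫ x, (|empiricalDensityField z (K x) - c₀| +
          ‖empiricalMomentumField z (K x) - c₀ • u‖ +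
          |empiricalEnergyField z (K x) - totalEnergyDensity c₀ u θ|))
        ∂localGibbsMeasure σ (fun _ => a) (fun _ => u) (fun _ => θ) N) ∧
    (∫⁻ z, (∫⁻ x, ENNReal.ofReal |empiricalEnergyField (Φ.flow t z) (K x) - totalEnergyDensity c₀ u θ|)
        ∂localGibbsLaw σ (fun _ => a) (fun _ => u) (fun _ => θ) N Φ ≤
      ∫⁻ z, ENNReal.ofReal (∫ x, (|empiricalDensityField z (K x) - c₀| +
          ‖empiricalMomentumField z (K x) - c₀ • u‖ +
          |empiricalEnergyField z (K x) - totalEnergyDensity c₀ u θ|))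
        ∂localGibbsMeasure σ (fun _ => a) (fun _ => u) (fun _ => θ) N) := by
  -- joint measurability of the three deviations and of their sum
  have hD : Measurable fun p : Config (N + 1) (Fin 3) T3 × T3 =>
      |empiricalDensityField p.1 (K p.2) - c₀| :=
    ((FluxClosureB5.measurable_density hK).sub_const _).abs
  have hM : Measurable fun p : Config (N + 1) (Fin 3) T3 × T3 =>
      ‖empiricalMomentumField p.1 (K p.2) - c₀ • u‖ :=
    ((FluxClosureB5.measurable_momentum hK).sub_const _).norm
  have hE : Measurable fun p : Config (N + 1) (Fin 3) T3 × T3 =>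
      |empiricalEnergyField p.1 (K p.2) - totalEnergyDensity c₀ u θ| :=
    ((FluxClosureB5.measurable_energy hK).sub_const _).abs
  set F : Config (N + 1) (Fin 3) T3 × T3 → ℝ := fun p =>
    |empiricalDensityField p.1 (K p.2) - c₀| + ‖empiricalMomentumField p.1 (K p.2) - c₀ • u‖ +
      |empiricalEnergyField p.1 (K p.2) - totalEnergyDensity c₀ u θ| with hF
  have hFm : Measurable F := (hD.add hM).add hE
  have hF0 : ∀ p, 0 ≤ F p := fun p => by rw [hF]; positivity
  -- integrability in the point, at a frozen configuration (bounded measurable on a probability space)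
  have hFi : ∀ z : Config (N + 1) (Fin 3) T3, Integrable (fun x => F (z, x)) volume := by
    intro z
    refine Integrable.of_bound (hFm.comp measurable_prodMk_left).aestronglyMeasurable
      (kb * (1 + (∑ i, ‖(z i).2‖) + (∑ i, ‖(z i).2‖) ^ 2) +
        (|c₀| + ‖c₀ • u‖ + |totalEnergyDensity c₀ u θ|)) (ae_of_all _ fun x => ?_)
    rw [Real.norm_eq_abs, abs_of_nonneg (hF0 _)]
    exact E1_devSum_le z (hK0 x) (hKb x) c₀ (totalEnergyDensity c₀ u θ) (c₀ • u)
  refine ⟨?_, ?_, ?_⟩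
  · exact E1_lintegral_lintegral_flow_le σ a θ u N Φ t hD
      (fun p => le_add_of_le_of_nonneg (le_add_of_nonneg_right (norm_nonneg _)) (abs_nonneg _)) hF0 hFi
  · exact E1_lintegral_lintegral_flow_le σ a θ u N Φ t hM
      (fun p => le_add_of_le_of_nonneg (le_add_of_nonneg_left (abs_nonneg _)) (abs_nonneg _)) hF0 hFi
  · exact E1_lintegral_lintegral_flow_le σ a θ u N Φ t hE
      (fun p => le_add_of_nonneg_left (add_nonneg (abs_nonneg _) (norm_nonneg _))) hF0 hFi

/-! ### The stub -/

/-- **E1 — HOMOGENEOUS FINE-SCALE LLN AT ALL TIMES (rung 0 of crux `FluxClosure`).** For constant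
profiles `(a, u, θ)` (`a, θ > 0`) and `σ < σ₀(a)` there is a constant `c₀ > 0` (the homogeneous density
`rhoLim (profileOf a) σ`) such that for every flow family, every kinetic window `ℓ_N` and the cube kernel,
the box density / momentum / energy of the evolved configuration at EVERY time `t` are `δ_N`-close in
iterated `L¹(P_N ⊗ dx)` to `(c₀, c₀ • u, totalEnergyDensity c₀ u θ)`, with `δ_N → 0` independent of `t`.
Proof: statics (`LGFS.statics_kernel` at the box kernel) + stationarity of the homogeneous local Gibbs
law under the flow (`measurePreserving_flow_localGibbsLaw_const`); see the module docstring. -/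
theorem homogeneous_fineScale_allTimes : ∀ (a θ : ℝ) (u : V3), 0 < a → 0 < θ → ∃ σ₀ : ℝ, 0 < σ₀ ∧ ∀ σ : ℝ, 0 < σ → σ < σ₀ → ∃ c₀ : ℝ, 0 < c₀ ∧ ∀ (Φ : (N : ℕ) → HardSphereFlow (Torus.geometry (Fin 3)) (hsDiameter σ N) (N + 1)) (ℓ : ℕ → ℝ), (∀ N, 0 < ℓ N ∧ ℓ N ≤ 1) → Tendsto ℓ atTop (𝓝 0) → Tendsto (fun N : ℕ => ℓ N ^ 3 * ((N : ℝ) + 1)) atTop atTop → let K := fun (l : ℝ) (x y : T3) => indicator {y' : T3 | ∀ i, ‖y' i - x i‖ < l / 2} (fun _ => (l ^ 3)⁻¹) y; let Dn := fun N t z x => empiricalDensityField ((Φ N).flow t z) (K (ℓ N) x); let Mm := fun N t z x => empiricalMomentumField ((Φ N).flow t z) (K (ℓ N) x); let En := fun N t z x => empiricalEnergyField ((Φ N).flow t z) (K (ℓ N) x); ∃ δ : ℕ → ℝ≥0∞, Tendsto δ atTop (𝓝 0) ∧ ∀ (N : ℕ) (t : ℝ), (∫⁻ z, (∫⁻ x,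 ENNReal.ofReal |Dn N t z x - c₀|) ∂(localGibbsLaw σ (fun _ => a) (fun _ => u) (fun _ => θ) N (Φ N)) ≤ δ N) ∧ (∫⁻ z, (∫⁻ x, ENNReal.ofReal ‖Mm N t z x - c₀ • u‖) ∂(localGibbsLaw σ (fun _ => a) (fun _ => u) (fun _ => θ) N (Φ N)) ≤ δ N) ∧ (∫⁻ z, (∫⁻ x, ENNReal.ofReal |En N t z x - totalEnergyDensity c₀ u θ|) ∂(localGibbsLaw σ (fun _ => a) (fun _ => u) (fun _ => θ) N (Φ N)) ≤ δ N) := by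
  intro a θ u ha hθ
  -- the cluster-expansion regime for the (constant) profile, with room for the positivity of `ρ₀`
  obtain ⟨σ₀, hσ₀, hσ₀P⟩ :=
    exists_smallDensity (profileOf (fun _ : T3 => a) continuous_const (fun _ => ha)) one_pos
  refine ⟨σ₀, hσ₀, fun σ hσ hσlt => ?_⟩
  obtain ⟨hs, hgeom⟩ := hσ₀P σ hσ hσlt
  have hσ2 : σ ≤ 1 / 2 := hs.σ_lt_half.le
  -- the normalised profile of a constant activity is `β ≡ 1`, so `ρ₀` is a constant `c₀ > 0`
  have hβ : ∀ x, (profileOf (fun _ : T3 => a) continuous_const (fun _ => ha)).β x = 1 := fun x => by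
    simp [profileOf_β, ha.ne']
  obtain ⟨c₀, hc₀⟩ : ∃ c₀ : ℝ, ∀ x,
      rhoLim (profileOf (fun _ : T3 => a) continuous_const (fun _ => ha)) σ x = c₀ :=
    ⟨rhoLim (profileOf (fun _ : T3 => a) continuous_const (fun _ => ha)) σ 0, fun x => by
      simp only [rhoLim, profileOf_β]⟩
  have hc₀pos : 0 < c₀ := by
    rw [← hc₀ 0]
    exact hs.rhoLim_pos (hgeom.trans_eq (hβ 0).symm)
  refine ⟨c₀, hc₀pos, fun Φ ℓ hℓ hℓ0 hℓ3 => ?_⟩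
  -- (i) the statics at the box kernel
  have hr : Tendsto (fun N : ℕ => ℓ N / 2) atTop (𝓝 0) := by simpa using hℓ0.div_const 2
  have hwin : Tendsto (fun N : ℕ => (ℓ N ^ 3)⁻¹ / ((N : ℝ) + 1)) atTop (𝓝 0) := by
    refine (hℓ3.inv_tendsto_atTop).congr fun N => ?_
    rw [Pi.inv_apply, mul_inv, div_eq_mul_inv]
  have key := LGFS.statics_kernel (u₀ := fun _ => u) (θ₀ := fun _ => θ) continuous_const
    continuous_const continuous_const (fun _ => ha) (fun _ => hθ) hσ2 hs
    (g := fun N x y => Set.indicator {y' : T3 | ∀ i, ‖y' i - x i‖ < ℓ N / 2} (fun _ => (ℓ N ^ 3)⁻¹) y)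
    (Cg := fun N => (ℓ N ^ 3)⁻¹) (r := fun N => ℓ N / 2)
    (fun N => LGFS.measurable_boxK_uncurry (ℓ N)) (fun N x y => LGFS.boxK_nonneg (hℓ N).1.le x y)
    (fun N x y => LGFS.boxK_le (hℓ N).1.le x y)
    (fun N x => LGFS.integral_boxK_right (hℓ N).1 (hℓ N).2 x)
    (fun N x y h => LGFS.dist_lt_of_boxK_ne_zero (hℓ N).1 h) hr hwin
  simp only [hc₀] at key
  -- (ii)+(iii) domination and transport along the flow, at every `N` and every time `t`
  dsimp only
  refine ⟨fun N => ∫⁻ z : Config (N + 1) (Fin 3) T3, ENNReal.ofReal (∫ x : T3,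
      (|empiricalDensityField z
          (Set.indicator {y' : T3 | ∀ i, ‖y' i - x i‖ < ℓ N / 2} (fun _ => (ℓ N ^ 3)⁻¹)) - c₀| +
        ‖empiricalMomentumField z
          (Set.indicator {y' : T3 | ∀ i, ‖y' i - x i‖ < ℓ N / 2} (fun _ => (ℓ N ^ 3)⁻¹)) - c₀ • u‖ +
        |empiricalEnergyField z
          (Set.indicator {y' : T3 | ∀ i, ‖y' i - x i‖ < ℓ N / 2} (fun _ => (ℓ N ^ 3)⁻¹)) -
            totalEnergyDensity c₀ u θ|))
      ∂localGibbsMeasure σ (fun _ => a) (fun _ => u) (fun _ => θ) N, ?_, fun N t => ?_⟩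
  · exact key
  · exact E1_boxDev_flow_le σ a θ u c₀ N (Φ N) t
      (K := fun x y => Set.indicator {y' : T3 | ∀ i, ‖y' i - x i‖ < ℓ N / 2} (fun _ => (ℓ N ^ 3)⁻¹) y)
      (LGFS.measurable_boxK_uncurry (ℓ N)) (fun x y => LGFS.boxK_nonneg (hℓ N).1.le x y)
      (fun x y => LGFS.boxK_le (hℓ N).1.le x y)

end E1
end FluxClosureEq
end Summit.AtomisticToContinuum.HydrodynamicLimit.Theorems

end
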